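import Literature.NumberTheory.EllipticCurves.PAdicBSD
import Literature.NumberTheory.EllipticCurves.IwasawaAlgebraCharIdealProofs
import HarnessLib

/-!
# bsd.S21 — the glue of Skinner–Urban's Thm. 3.6.9: two divisibilities give the main conjecture

`Proofs` companion (theorems only, no new definitions, no new named facts) of
`Literature.NumberTheory.EllipticCurves.PAdicBSD` for the named fact
`Literature.NumberTheory.EllipticCurves.skinner_urban_main_conjecture` (**bsd.S21**; C. Skinner,
E. Urban, *The Iwasawa main conjectures for `GL₂`*, Invent. Math. 195 (2014), Thm. 3.6.9, p. 45).

The fact itself — the cyclotomic Iwasawa main conjecture `char_Λ X(E/ℚ_∞) = (L_p(E, T))` for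
`E/ℚ` good ordinary at an odd prime `p` with `E[p]` irreducible and ramified at some `q ‖ N` — is
**not** discharged here: its printed proof is Kato's Euler-system divisibility (Kato, Astérisque 295
(2004), Thm. 17.4 = S–U Thm. 3.5.6, p. 41; the tree's named fact `kato_divisibility`, undischarged)
together with the opposite divisibility "`p`-adic `L`-function divides characteristic ideal", the
main theorem of S–U (Thm. 3.6.1 = "Theorem 3", a three-variable divisibility over an imaginary
quadratic field for Hida families, proved in §§4–13 through the Eisenstein ideal of `GU(2,2)`;
descended to `ℚ_∞` as Cor. 3.6.3, p. 42, and combined with Kato's theorem in the proof of Thm. 3.6.4,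
p. 43). None of the prerequisites (Galois cohomology of number fields, `Λ`-adic forms, automorphic
forms on unitary groups) is in Mathlib.

What *is* formalised here is the final step of the printed proof line (S–U p. 4: "In essence the
result is an inclusion (divisibility) in the opposite direction from that in Kato's theorem.
Combining the results then yields equality."; proof of Thm. 3.6.4, p. 43), in the vocabulary of
`PAdicBSD` (`Λ = ℤ_p⟦T⟧ = IwasawaAlgebra p`, `ι = iwasawaToPowerSeries p : Λ ↪ ℚ_p⟦T⟧`,
`L = L_p(E, T) = padicLFunction f (unitRoot W p)`, "in `Λ ⊗ ℚ_p`" spelled with explicit powers of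
`p` as in the module docstring of `PAdicBSD`):

* `exists_span_eq_and_map_eq_C_zpow_mul` — the bookkeeping in `Λ ⊗_{ℤ_p} ℚ_p`: if `(g) ∋ g₁` with
  `ι g₁ = p^a L` (Kato's inclusion `(L) ⊆ char X` in `Λ ⊗ ℚ_p`) and `p^m g ∈ (G)` with
  `ι G = p^n L` (the opposite inclusion `char X ⊆ (L)` in `Λ ⊗ ℚ_p`), then `(g) = (g')` for some
  `g'` with `ι g' = p^k L`, `k ∈ ℤ`; the proof is the one on p. 43: in the domain `Λ` the quotient of
  the two generators divides a power of the prime element `p` of `Λ` (tree theorem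
  `IwasawaAlgebra.prime_C`, file `IwasawaAlgebraCharIdealProofs`), hence is `p^c ·` unit (Mathlib
  `dvd_prime_pow`).
* `span_eq_span_of_map_eq_of_mem` — the integral bookkeeping: `(g) ∋ g₂` with `ι g₂ = L` and
  `g ∈ (G)` with `ι G = L` force `(g) = (G)`.
* `skinner_urban_main_conjecture_of_kato_divisibility` — **bsd.S21 from bsd.S20 plus the
  Skinner–Urban direction**: `kato_divisibility` (clauses: `X` torsion; `p^a L ∈ ι(char X)`;
  `L ∈ ι(char X)` under surjectivity of `ρ_{E,p}`) together with the hypothesis `hsu` — the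
  '`⊆`' halves of the two sentences of Thm. 3.6.9: `char X ⊆ (L)` in `Λ ⊗ ℚ_p`, and in `Λ` when
  `ρ_{E,p}` is surjective — imply `skinner_urban_main_conjecture` (all three clauses). The hypothesis
  `hsu` is stated inline (D-0026: no new named fact); it is implied by Thm. 3.6.9 as printed and is
  the exact shape in which S–U's own contribution enters the elliptic-curve statement, so that a
  future vendoring of Thm. 3.6.1/Cor. 3.6.3 closes bsd.S21 through this theorem and
  `kato_divisibility` alone. The characteristic ideal is principal by the tree theorem
  `charIdeal_isPrincipal_holds` (`Λ` is a UFD).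

## References

* C. Skinner, E. Urban, *The Iwasawa main conjectures for `GL₂`*, Invent. Math. 195 (2014),
  1–277: §1.1 (p. 1, `p` odd), p. 4, Thm. 3.5.6 (p. 41), Thm. 3.6.1 (p. 41), Cor. 3.6.2–3.6.3
  (p. 42), Thm. 3.6.4 and its proof (p. 43), §3.6.7, Conj. 3.6.8 and Thm. 3.6.9 (p. 45).
  [SkinnerUrban2014]
* K. Kato, *`p`-adic Hodge theory and values of zeta functions of modular forms*, Astérisque 295
  (2004), Thm. 17.4. [Kato2004Asterisque]
* L. Washington, *Introduction to Cyclotomic Fields*, GTM 83, §13.1–13.2 (`Λ/(p) ≅ 𝔽_p⟦T⟧`,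
  characteristic ideals). [Washington1997]

## Design

Theorems only, `namespace Literature.NumberTheory.EllipticCurves`; axioms of every theorem:
`propext`, `Classical.choice`, `Quot.sound`. Imports `IwasawaAlgebraCharIdealProofs` (primality of
`p` in `Λ`), which imports only `IwasawaAlgebra(Proofs)` and Mathlib (no cycle with `PAdicBSD`).
-/

set_option autoImplicit false

noncomputable section

open scoped Classical MatrixGroups ModularForm

open CongruenceSubgroup WeierstrassCurve Literature.NumberTheory.EllipticCurves.ModularForms

namespace Literature.NumberTheory.EllipticCurves

/-! ### Algebra in `Λ = ℤ_p⟦T⟧` and `Λ ⊗ ℚ_p ⊆ ℚ_p⟦T⟧` -/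

section Algebra

variable (p : ℕ) [Fact p.Prime]

/-- `ι (p^m) = p^m`: the inclusion `ι : Λ ↪ ℚ_p⟦T⟧` sends the constant `p^m ∈ ℤ_p` to the constant
`p^m ∈ ℚ_p` (coefficientwise `ℤ_p ↪ ℚ_p`). [folklore] -/
theorem iwasawaToPowerSeries_C_natCast_pow (m : ℕ) :
    iwasawaToPowerSeries p (PowerSeries.C ((p : ℤ_[p]) ^ m)) =
      PowerSeries.C ((p : ℚ_[p]) ^ m) := by
  rw [iwasawaToPowerSeries, PowerSeries.map_C, map_pow, map_natCast]

/-- The constant power series `p^a ∈ ℚ_p⟦T⟧` (`a ∈ ℤ`) is nonzero. [folklore] -/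
theorem C_natCast_zpow_ne_zero (a : ℤ) : (PowerSeries.C ((p : ℚ_[p]) ^ a) : PowerSeries ℚ_[p]) ≠ 0 := by
  intro h
  rw [← map_zero (PowerSeries.C (R := ℚ_[p])), PowerSeries.C_injective.eq_iff] at h
  exact zpow_ne_zero a (Nat.cast_ne_zero.mpr (Fact.out : p.Prime).ne_zero) h

/-- **Two divisibilities in `Λ ⊗ ℚ_p` give equality of principal ideals up to a power of `p`**
(the bookkeeping of the proof of Skinner–Urban, Thm. 3.6.4, p. 43, in the vocabulary of
`PAdicBSD`). In `Λ = ℤ_p⟦T⟧` with `ι : Λ ↪ ℚ_p⟦T⟧` and `L ∈ ℚ_p⟦T⟧`: if `g₁ ∈ (g)` has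
`ι g₁ = p^a · L` (Kato: `(L) ⊆ (g)` in `Λ ⊗ ℚ_p`) and `p^m · g ∈ (G)` where `ι G = p^n · L`
(Skinner–Urban: `(g) ⊆ (L)` in `Λ ⊗ ℚ_p`), then `(g) = (g')` for some `g' ∈ Λ` with
`ι g' = p^k · L`, `k ∈ ℤ` — i.e. `(g) = (L)` in `Λ ⊗_{ℤ_p} ℚ_p`, whose units are `p^ℤ · Λˣ`. Proof:
if `g = 0` then `L = 0`; otherwise `g₁ = s g`, `p^m g = r G` give `r s p^n = p^{m+a}` in the domain
`Λ`, so `s` divides a power of the prime `p` of `Λ` (tree theorem `IwasawaAlgebra.prime_C`,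
`Λ/(p) ≅ 𝔽_p⟦T⟧`) and is `p^c u` with `u` a unit (Mathlib `dvd_prime_pow`); take `g' = u g`,
`k = a - c`.
[cite: SkinnerUrban2014, Thm. 3.6.4, proof (p. 43)] -/
theorem exists_span_eq_and_map_eq_C_zpow_mul {g g₁ G : IwasawaAlgebra p} {L : PowerSeries ℚ_[p]}
    {a m n : ℕ} (hg₁ : g₁ ∈ Ideal.span {g})
    (hιg₁ : iwasawaToPowerSeries p g₁ = PowerSeries.C ((p : ℚ_[p]) ^ a) * L)
    (hG : PowerSeries.C ((p : ℤ_[p]) ^ m) * g ∈ Ideal.span {G})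
    (hιG : iwasawaToPowerSeries p G = PowerSeries.C ((p : ℚ_[p]) ^ n) * L) :
    ∃ (g' : IwasawaAlgebra p) (k : ℤ), Ideal.span {g} = Ideal.span {g'} ∧
      iwasawaToPowerSeries p g' = PowerSeries.C ((p : ℚ_[p]) ^ k) * L := by
  have hp0 : (p : ℚ_[p]) ≠ 0 := Nat.cast_ne_zero.mpr (Fact.out : p.Prime).ne_zero
  obtain ⟨s, rfl⟩ := Ideal.mem_span_singleton'.mp hg₁
  obtain ⟨r, hr⟩ := Ideal.mem_span_singleton'.mp hG
  by_cases hg0 : g = 0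
  · -- `g = 0`: then `p^a L = ι (s g) = 0`, so `L = 0`, and `g' = 0`, `k = 0` work.
    subst hg0
    have hL : L = 0 := by
      have h0 : PowerSeries.C ((p : ℚ_[p]) ^ a) * L = 0 := by rw [← hιg₁, mul_zero, map_zero]
      exact (mul_eq_zero.mp h0).resolve_left (by simpa using C_natCast_zpow_ne_zero p a)
    exact ⟨0, 0, rfl, by simp [hL]⟩
  · -- `g ≠ 0`: compare the two expressions of `ι g` and cancel.
    set ι := iwasawaToPowerSeries p with hι
    have hιinj : Function.Injective ι := iwasawaToPowerSeries_injective p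
    have hιg0 : ι g ≠ 0 := fun h => hg0 (hιinj (by rw [h, map_zero]))
    -- `ι r * p^n * L = p^m * ι g` and `ι s * ι g = p^a * L`
    have e1 : ι r * (PowerSeries.C ((p : ℚ_[p]) ^ n) * L) = PowerSeries.C ((p : ℚ_[p]) ^ m) * ι g := by
      rw [← hιG, ← map_mul, hr, map_mul, iwasawaToPowerSeries_C_natCast_pow]
    have e2 : ι s * ι g = PowerSeries.C ((p : ℚ_[p]) ^ a) * L := by rw [← map_mul, hιg₁]
    -- hence `ι (r * s * p^n) * ι g = ι (p^(m+a)) * ι g`, and cancel `ι g ≠ 0`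
    have e3 : ι (r * s * PowerSeries.C ((p : ℤ_[p]) ^ n)) * ι g =
        ι (PowerSeries.C ((p : ℤ_[p]) ^ (m + a))) * ι g := by
      rw [map_mul, map_mul, iwasawaToPowerSeries_C_natCast_pow, iwasawaToPowerSeries_C_natCast_pow,
        pow_add, map_mul]
      calc ι r * ι s * PowerSeries.C ((p : ℚ_[p]) ^ n) * ι g
          = ι r * (PowerSeries.C ((p : ℚ_[p]) ^ n) * (ι s * ι g)) := by ring
        _ = ι r * (PowerSeries.C ((p : ℚ_[p]) ^ n) * (PowerSeries.C ((p : ℚ_[p]) ^ a) * L)) := by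
            rw [e2]
        _ = PowerSeries.C ((p : ℚ_[p]) ^ a) * (ι r * (PowerSeries.C ((p : ℚ_[p]) ^ n) * L)) := by
            ring
        _ = PowerSeries.C ((p : ℚ_[p]) ^ m) * PowerSeries.C ((p : ℚ_[p]) ^ a) * ι g := by
            rw [e1]; ring
    have e4 : r * s * PowerSeries.C ((p : ℤ_[p]) ^ n) = PowerSeries.C ((p : ℤ_[p]) ^ (m + a)) :=
      hιinj (mul_right_cancel₀ hιg0 e3)
    -- so `s ∣ p^(m+a)` in `Λ`, whence `s = p^c * u` with `u` a unit
    have hs : s ∣ (PowerSeries.C (p : ℤ_[p]) : IwasawaAlgebra p) ^ (m + a) := by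
      refine ⟨r * PowerSeries.C ((p : ℤ_[p]) ^ n), ?_⟩
      rw [← map_pow, ← e4]; ring
    obtain ⟨c, -, hc⟩ := (dvd_prime_pow (IwasawaAlgebra.prime_C p) (m + a)).mp hs
    obtain ⟨u, hu⟩ := hc.symm
    -- `hu : C p ^ c * u = s`; take `g' = u * g`, `k = a - c`
    refine ⟨(u : IwasawaAlgebra p) * g, (a : ℤ) - c, (Ideal.span_singleton_mul_left_unit u.isUnit g).symm, ?_⟩
    have e5 : PowerSeries.C ((p : ℚ_[p]) ^ c) * (ι u * ι g) = PowerSeries.C ((p : ℚ_[p]) ^ a) * L := by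
      rw [← e2, ← hu]
      simp only [hι, iwasawaToPowerSeries, map_mul, map_pow, map_natCast]
      ring
    have hCc : (PowerSeries.C ((p : ℚ_[p]) ^ c) : PowerSeries ℚ_[p]) ≠ 0 := by
      simpa using C_natCast_zpow_ne_zero p c
    refine mul_left_cancel₀ hCc ?_
    rw [map_mul, e5, ← mul_assoc, ← map_mul]
    congr 2
    rw [zpow_sub₀ hp0, zpow_natCast, zpow_natCast, mul_div_assoc', mul_comm, mul_div_assoc,
      div_self (pow_ne_zero c hp0), mul_one]

/-- **Two integral divisibilities give equality of principal ideals** (the integral case of the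
bookkeeping in the proof of Skinner–Urban, Thm. 3.6.4, p. 43). If `g₂ ∈ (g)` has `ι g₂ = L`
(Kato's integral divisibility `(L) ⊆ (g)`) and `g ∈ (G)` with `ι G = L` (the opposite integral
divisibility `(g) ⊆ (L)`), then `(g) = (G)`: indeed `g₂ = G` by injectivity of `ι`, so
`G = s r G` and either `G = 0 = g` or `r` is a unit. [cite: SkinnerUrban2014, Thm. 3.6.4, proof (p. 43)] -/
theorem span_eq_span_of_map_eq_of_mem {g g₂ G : IwasawaAlgebra p} {L : PowerSeries ℚ_[p]}
    (hg₂ : g₂ ∈ Ideal.span {g}) (hιg₂ : iwasawaToPowerSeries p g₂ = L) (hgG : g ∈ Ideal.span {G})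
    (hιG : iwasawaToPowerSeries p G = L) : Ideal.span {g} = Ideal.span {G} := by
  obtain ⟨s, rfl⟩ := Ideal.mem_span_singleton'.mp hg₂
  obtain ⟨r, rfl⟩ := Ideal.mem_span_singleton'.mp hgG
  have hG : s * r * G = 1 * G := by
    rw [one_mul, mul_assoc]
    exact iwasawaToPowerSeries_injective p (hιg₂.trans hιG.symm)
  by_cases hG0 : G = 0
  · subst hG0
    simp
  · have hr : IsUnit r := IsUnit.of_mul_eq_one s (by rw [mul_comm]; exact mul_right_cancel₀ hG0 hG)
    exact Ideal.span_singleton_mul_left_unit hr G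

end Algebra

/-! ### bsd.S21 from bsd.S20 and the Skinner–Urban direction -/

section SkinnerUrban

variable (W : WeierstrassCurve ℚ) [W.IsGloballyMinimal] (p : ℕ) [Fact p.Prime]
  {κ : ZpExtension ℚ p} {γ : Field.absoluteGaloisGroup ℚ} {N : ℕ} [NeZero N]
  {f : CuspForm (Gamma0 N) 2}

/-- **bsd.S21 (Skinner–Urban, Thm. 3.6.9) from bsd.S20 (Kato) and the opposite divisibility.**
Let `E/ℚ` (globally minimal `W`), `p`, `κ`, `γ`, `f` be as in `skinner_urban_main_conjecture`, and
write `X = D.X`, `L = L_p(E, T) = padicLFunction f (unitRoot W p)`, `ι : Λ ↪ ℚ_p⟦T⟧`. Assume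
* `hkato`: Kato's theorem `kato_divisibility W p` (Kato 2004, Thm. 17.4 = S–U Thm. 3.5.6, p. 41):
  for `p ≠ 2` good ordinary, `X` is `Λ`-torsion, `p^a L = ι g₁` with `g₁ ∈ char_Λ X`, and
  `L = ι g₂` with `g₂ ∈ char_Λ X` if `ρ_{E,p}` is surjective;
* `hsu`: the Skinner–Urban direction, i.e. the '`⊆`' halves of the two sentences of Thm. 3.6.9
  (p. 45) under its hypotheses (`p ≥ 3` good ordinary, `ρ̄_{E,p}` irreducible, some `ℓ ‖ N`,
  `ℓ ≠ p`, with `ρ̄_{E,p}` ramified at `ℓ`): `char_Λ X ⊆ (L)` in `Λ ⊗_{ℤ_p} ℚ_p` — there are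
  `m, n ≥ 0` and `G ∈ Λ` with `ι G = p^n L` and `p^m · char_Λ X ⊆ (G)` — and, if `ρ_{E,p}` is
  surjective (`∀ n, W.HasSurjectiveModNGaloisRep (p^n)`), `char_Λ X ⊆ (G)` for some `G ∈ Λ` with
  `ι G = L`. (This is how S–U's main theorem, Thm. 3.6.1 / Cor. 3.6.3 — "`p`-adic `L`-function
  divides characteristic ideal" — enters the proof of Thm. 3.6.4, p. 43; as a statement about `E`
  alone it is implied by Thm. 3.6.9 and is not discharged in the tree.)
Then `skinner_urban_main_conjecture W p` holds for these data: `X` is torsion (Kato), `char_Λ X =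
(g)` with `ι g = p^k L`, `k ∈ ℤ` (`exists_span_eq_and_map_eq_C_zpow_mul`), and under surjectivity
`char_Λ X = (G)` with `ι G = L` (`span_eq_span_of_map_eq_of_mem`); `char_Λ X` is principal by
`charIdeal_isPrincipal_holds` and `IsOrdinaryAt W p` is `hgood ∧ hord` by definition.
S–U p. 4: "Combining the results then yields equality." [cite: SkinnerUrban2014, Thm. 3.6.9 (p. 45) and proof of Thm. 3.6.4 (p. 43)] -/
theorem skinner_urban_main_conjecture_of_kato_divisibility
    (hkato : kato_divisibility W p (κ := κ) (γ := γ) (f := f))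
    (hsu : ∀ (_hp : 3 ≤ p) (_hgood : W.HasGoodReductionAtPrime p)
      (_hord : ¬ (p : ℤ) ∣ W.frobeniusTrace p) (_hirr : W.HasIrreducibleModPGaloisRep p)
      (_haux : ∃ ℓ : ℕ, ∃ _ : Fact ℓ.Prime, ℓ ≠ p ∧ W.HasMultiplicativeReductionAtPrime ℓ ∧
        ¬ p ∣ padicValInt ℓ W.minimalDiscriminantInt)
      (_hκ : κ.IsCyclotomic) (_hγ : κ.IsTopGenerator γ) (_hγ' : IsCyclotomicVariable p γ)
      (_hf : IsNewformOf W f) (D : W.SelmerDualData κ γ),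
      (∃ (m n : ℕ) (G : IwasawaAlgebra p),
        iwasawaToPowerSeries p G =
            PowerSeries.C ((p : ℚ_[p]) ^ n) * padicLFunction f (unitRoot W p : ℚ_[p]) ∧
          ∀ x ∈ D.charIdeal, PowerSeries.C ((p : ℤ_[p]) ^ m) * x ∈ Ideal.span {G}) ∧
      ((∀ n : ℕ, W.HasSurjectiveModNGaloisRep (p ^ n : ℕ)) →
        ∃ G : IwasawaAlgebra p,
          iwasawaToPowerSeries p G = padicLFunction f (unitRoot W p : ℚ_[p]) ∧
            D.charIdeal ≤ Ideal.span {G})) :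
    skinner_urban_main_conjecture W p (κ := κ) (γ := γ) (f := f) := by
  intro hp hgood hord hirr haux hκ hγ hγ' hf D
  have hp2 : p ≠ 2 := by omega
  obtain ⟨htors, ⟨a, g₁, hg₁, hιg₁⟩, hint⟩ := hkato hp2 ⟨hgood, hord⟩ hκ hγ hγ' hf D
  obtain ⟨⟨m, n, G, hιG, hG⟩, hint'⟩ := hsu hp hgood hord hirr haux hκ hγ hγ' hf D
  -- a generator `g` of the (principal) characteristic ideal
  haveI : (Module.charIdeal (IwasawaAlgebra p) D.X).IsPrincipal := charIdeal_isPrincipal_holds p D.X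
  obtain ⟨g, hg⟩ := Submodule.IsPrincipal.principal (Module.charIdeal (IwasawaAlgebra p) D.X)
  have hchar : D.charIdeal = Ideal.span {g} := hg
  refine ⟨htors, ?_, ?_⟩
  · -- clause 2: equality in `Λ ⊗ ℚ_p`
    rw [hchar] at hg₁ hG
    obtain ⟨g', k, hspan, hι⟩ := exists_span_eq_and_map_eq_C_zpow_mul p hg₁ hιg₁
      (hG g (Ideal.mem_span_singleton_self g)) hιG
    exact ⟨g', k, hchar.trans hspan, hι⟩
  · -- clause 3: equality in `Λ` under surjectivity of `ρ_{E,p}`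
    intro hsurj
    obtain ⟨g₂, hg₂, hιg₂⟩ := hint hsurj
    obtain ⟨G', hιG', hle⟩ := hint' hsurj
    rw [hchar] at hg₂ hle
    exact ⟨G', hιG', hchar.trans (span_eq_span_of_map_eq_of_mem p hg₂ hιg₂
      ((Ideal.span_singleton_le_iff_mem _).mp hle) hιG')⟩

end SkinnerUrban

end Literature.NumberTheory.EllipticCurves

end
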